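import Summits.QuantumAdvantage.AdviceFreeQNC0.AffBells35WRELStructure

/-!
# qa-qnc0-p1 g35 — `PolyLossOfWREL` and the wired-elimination line, part 6/7: twin blocks, twin crowds, H-private pairs

Continuation of `AffBells35WRELStructure`.

Ported to the tree VERBATIM (split into seven files `AffBells35PolyLossOfWREL` / `AffBells35WREL{Firing,Quiet,Typical,Structure,Twins,Toggle}` for the 400-line rule; lint fixes only: `push Not`, `card_filter_add_card_filter_not`, unused simp arguments, two `_`-binders) by the prover seat qn-prover-3 g20 at the ask of planner qa-qnc0-p1 g36 (INBOX 11:15Z: exp35/WREL35.lean FROZEN, 1891 l., farm rc 0 / 0 sorry); authored and proved by the planner seat qa-qnc0-p1 g35.  Serves the crux stmt-QuantumAdvantage-22907 (route DWalkThree); untagged (the gate refuses `--supports` across sub-problems on AdviceFreeQNC0/ targets).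
-/

noncomputable section
open Classical

namespace Summit.QuantumAdvantage.AdviceFreeQNC0.AffBells35

open Finset Literature.Computability.QuantumComplexity Literature.Computability.QuantumComplexity.RingHLF
open AffBells23 Fib19 AffBells26 AffBells29

variable {N : ℕ}

section TwinBlock

open AffBells33 AffBells28 AffBells28lit

variable {Z K : ℕ}

/-- two-point count. -/
def cnt2 (s r₁ r₂ : ZMod 3) : ℕ := (if s = r₁ then 1 else 0) + (if s = r₂ then 1 else 0)

/-- the `ZMod 3` endgame of the twin-block lemma: shift-parity-invariance of `cnt2` at the four sums `0, a, b, a+b`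
(which cover `ZMod 3`) forces equal residues. -/
theorem twinBlock_endgame : ∀ δ a b r₁ r₂ : ZMod 3, δ ≠ 0 → a ≠ 0 → b ≠ 0 →
    cnt2 0 r₁ r₂ % 2 = cnt2 (0 + δ) r₁ r₂ % 2 →
    cnt2 (a + 0) r₁ r₂ % 2 = cnt2 (a + 0 + δ) r₁ r₂ % 2 →
    cnt2 (b + 0) r₁ r₂ % 2 = cnt2 (b + 0 + δ) r₁ r₂ % 2 →
    cnt2 (a + b) r₁ r₂ % 2 = cnt2 (a + b + δ) r₁ r₂ % 2 → r₁ = r₂ := by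
  unfold cnt2; decide

/-- `tsum_zeroY` (planner qa-qnc0-p1 g35, exp35/WREL35.lean; see the section header above). -/
theorem tsum_zeroY (P : Fin K → Fin Z → ZMod 3) (b : Fin K) : tsum P (fun _ => false) b = 0 := by
  unfold tsum; simp

/-- `tsum_pairY` (planner qa-qnc0-p1 g35, exp35/WREL35.lean; see the section header above). -/
theorem tsum_pairY (P : Fin K → Fin Z → ZMod 3) {u v : Fin Z} (huv : u ≠ v) (b : Fin K) :
    tsum P (pairY u v) b = P b u + P b v := by
  unfold tsum; exact sum_pairY huv _

/-- `pairY_apply_of_ne` (planner qa-qnc0-p1 g35, exp35/WREL35.lean; see the section header above). -/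
theorem pairY_apply_of_ne {u v t : Fin Z} (hu : t ≠ u) (hv : t ≠ v) : pairY u v t = false := by
  unfold pairY; simp [hu, hv]

/-- cardinality of a filter supported on the twin pair. -/
theorem card_filter_twins (P : Fin K → Fin Z → ZMod 3) {t₀ : Fin Z} {h₁ h₂ : Fin K} (h12 : h₁ ≠ h₂)
    (htwin : ∀ t, P h₂ t = P h₁ t) (hδ : P h₁ t₀ ≠ 0) (hH : ∀ b, P b t₀ ≠ 0 → b = h₁ ∨ b = h₂)
    (Q : Fin K → Prop) [DecidablePred Q] :
    (univ.filter fun b => P b t₀ ≠ 0 ∧ Q b).card = (if Q h₁ then 1 else 0) + (if Q h₂ then 1 else 0) := by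
  have hset : (univ.filter fun b => P b t₀ ≠ 0 ∧ Q b) = ({h₁, h₂} : Finset (Fin K)).filter Q := by
    ext b
    simp only [mem_filter, mem_univ, true_and, mem_insert, mem_singleton]
    constructor
    · rintro ⟨hb, hq⟩; exact ⟨hH b hb, hq⟩
    · rintro ⟨hb, hq⟩
      rcases hb with rfl | rfl
      · exact ⟨hδ, hq⟩
      · exact ⟨by rw [htwin]; exact hδ, hq⟩
  rw [hset, filter_insert, filter_singleton]
  by_cases hq1 : Q h₁ <;> by_cases hq2 : Q h₂ <;> simp [hq1, hq2, h12]

/-- **TWIN-BLOCK LEMMA in test coordinates (the `|H| = 2` case of the gadget classification, ROUND-34 §12.12(v)(7)).**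
Two twin rows (equal test coefficients) that alone read coin `t₀`, with a free coin `t₁` and two further coins `t₂, t₃` they read, can sit
in a perfect fibre only with EQUAL residues (and then they form a silent pair). -/
theorem twinBlock (P : Fin K → Fin Z → ZMod 3) (r : Fin K → ZMod 3) (τ : ℕ) {t₀ t₁ t₂ t₃ : Fin Z}
    (h01 : t₀ ≠ t₁) (h02 : t₀ ≠ t₂) (h03 : t₀ ≠ t₃) (h12 : t₁ ≠ t₂) (h13 : t₁ ≠ t₃) (h23 : t₂ ≠ t₃)
    (hfree : ∀ b, P b t₁ = 0) {h₁ h₂ : Fin K} (hne : h₁ ≠ h₂) (htwin : ∀ t, P h₂ t = P h₁ t)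
    (hδ : P h₁ t₀ ≠ 0) (ha : P h₁ t₂ ≠ 0) (hb : P h₁ t₃ ≠ 0) (hH : ∀ b, P b t₀ ≠ 0 → b = h₁ ∨ b = h₂)
    (hperf : ∀ y : Fin Z → Bool, AffBells33.onesCard y % 2 = 0 → testCount P r τ y % 2 = 0) :
    r h₁ = r h₂ := by
  -- the window flip at a base point `y` with `y t₀ = false`, read on the twin pair
  have step : ∀ y : Fin Z → Bool, AffBells33.onesCard y % 2 = 0 → y t₀ = false →
      cnt2 (tsum P y h₁) (r h₁) (r h₂) % 2 = cnt2 (tsum P y h₁ + P h₁ t₀) (r h₁) (r h₂) % 2 := by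
    intro y hy hy0
    have hy' : AffBells33.onesCard (wflip t₀ t₁ y) % 2 = 0 := by rw [onesCard_wflip h01 y hy0]; exact hy
    have hw := windowFlip_count P r τ h01 hfree y hy0 (by rw [hperf y hy, hperf _ hy'])
    have hs2 : tsum P y h₂ = tsum P y h₁ := by
      unfold tsum; exact sum_congr rfl fun t _ => by rw [htwin]
    rw [card_filter_twins P hne htwin hδ hH, card_filter_twins P hne htwin hδ hH] at hw
    rw [hs2, htwin] at hw
    unfold cnt2
    exact hw
  have e0 := step (fun _ => false) onesCard_zeroY rfl
  have e2 := step (pairY t₂ t₁) (onesCard_pairY h12.symm) (pairY_apply_of_ne h02 h01)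
  have e3 := step (pairY t₃ t₁) (onesCard_pairY h13.symm) (pairY_apply_of_ne h03 h01)
  have e23 := step (pairY t₂ t₃) (onesCard_pairY h23) (pairY_apply_of_ne h02 h03)
  rw [tsum_zeroY] at e0
  rw [tsum_pairY P h12.symm, hfree h₁] at e2
  rw [tsum_pairY P h13.symm, hfree h₁] at e3
  rw [tsum_pairY P h23] at e23
  exact twinBlock_endgame (P h₁ t₀) (P h₁ t₂) (P h₁ t₃) (r h₁) (r h₂) hδ ha hb e0 e2 e3 e23

end TwinBlock


section TwinBlockFibre

open AffBells33 AffBells28 AffBells28lit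

/-- The fibre form of the twin-block lemma: on a perfect fibre, fibre-twins that alone read a coin (with a free coin and two further
coins available) have equal residual targets `testRhs` — they are a SILENT PAIR. -/
theorem twinBlock_perfect (hN : 3 ≤ N) (β : Fin N → Fin N → ZMod 3) (c : Fin N → ZMod 3) (x : Fin N → Bool)
    (hodd : IsOdd x) (hperf : PerfectFibre β c (kline x)) {t₀ t₁ t₂ t₃ : Fin (coinsOf x).card}
    (h01 : t₀ ≠ t₁) (h02 : t₀ ≠ t₂) (h03 : t₀ ≠ t₃) (h12 : t₁ ≠ t₂) (h13 : t₁ ≠ t₃) (h23 : t₂ ≠ t₃)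
    (hfree : ∀ b, testMat β x b t₁ = 0) {h₁ h₂ : Fin N} (hne : h₁ ≠ h₂)
    (htwin : ∀ t, testMat β x h₂ t = testMat β x h₁ t) (hδ : testMat β x h₁ t₀ ≠ 0)
    (ha : testMat β x h₁ t₂ ≠ 0) (hb : testMat β x h₁ t₃ ≠ 0)
    (hH : ∀ b, testMat β x b t₀ ≠ 0 → b = h₁ ∨ b = h₂) :
    testRhs β c x h₁ = testRhs β c x h₂ :=
  twinBlock (testMat β x) (testRhs β c x) (tauOf x) h01 h02 h03 h12 h13 h23 hfree hne htwin hδ ha hb hH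
    fun _ hy => (rel_xOf_iff hN hodd hy).1 (hperf _ (isOdd_xOf hodd hy) (kline_xOf hN hodd hy))

end TwinBlockFibre


section TwinCrowd

open AffBells33 AffBells28 AffBells28lit

variable {Z K : ℕ}

/-- parity endgame of the twin-crowd lemma: a parity vector on `ZMod 3` invariant under the shift `δ ≠ 0` at the points
`0, a, b, a+b` (`a, b ≠ 0`, so these cover `ZMod 3`) is constant. -/
theorem twinCrowd_endgame : ∀ δ a b : ZMod 3, δ ≠ 0 → a ≠ 0 → b ≠ 0 → ∀ q : ZMod 3 → Fin 2,
    q 0 = q (0 + δ) → q (a + 0) = q (a + 0 + δ) → q (b + 0) = q (b + 0 + δ) → q (a + b) = q (a + b + δ) →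
    q 0 = q 1 ∧ q 1 = q 2 := by
  decide

/-- cardinality of a filter supported on a twin crowd `H`, when the predicate only sees the residue. -/
theorem card_filter_crowd (P : Fin K → Fin Z → ZMod 3) (r : Fin K → ZMod 3) {t₀ : Fin Z} (H : Finset (Fin K))
    (hH : ∀ b, P b t₀ ≠ 0 ↔ b ∈ H) (Q : ZMod 3 → Prop) [DecidablePred Q] :
    (univ.filter fun b => P b t₀ ≠ 0 ∧ Q (r b)).card = (H.filter fun b => Q (r b)).card := by
  congr 1
  ext b
  simp only [mem_filter, mem_univ, true_and, hH b]

/-- **TWIN-CROWD LEMMA in test coordinates (ROUND-34 §12.12(v)(7); the balance condition of (t)(3) made exact).**  A crowd `H` of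
pairwise fibre-twins that are exactly the rows reading coin `t₀`, with a free coin `t₁` and two further coins `t₂, t₃` read by the crowd,
sits in a perfect fibre only if its residue counts `n_a = #{h ∈ H : r_h = a}` satisfy `n₀ ≡ n₁ ≡ n₂ (mod 2)`. -/
theorem twinCrowd (P : Fin K → Fin Z → ZMod 3) (r : Fin K → ZMod 3) (τ : ℕ) {t₀ t₁ t₂ t₃ : Fin Z}
    (h01 : t₀ ≠ t₁) (h02 : t₀ ≠ t₂) (h03 : t₀ ≠ t₃) (h12 : t₁ ≠ t₂) (h13 : t₁ ≠ t₃) (h23 : t₂ ≠ t₃)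
    (hfree : ∀ b, P b t₁ = 0) (H : Finset (Fin K)) {h₁ : Fin K} (_hh₁ : h₁ ∈ H)
    (htwin : ∀ h ∈ H, ∀ t, P h t = P h₁ t) (hδ : P h₁ t₀ ≠ 0) (ha : P h₁ t₂ ≠ 0) (hb : P h₁ t₃ ≠ 0)
    (hH : ∀ b, P b t₀ ≠ 0 ↔ b ∈ H)
    (hperf : ∀ y : Fin Z → Bool, AffBells33.onesCard y % 2 = 0 → testCount P r τ y % 2 = 0) :
    (H.filter fun h => r h = 0).card % 2 = (H.filter fun h => r h = 1).card % 2 ∧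
      (H.filter fun h => r h = 1).card % 2 = (H.filter fun h => r h = 2).card % 2 := by
  -- residue-count parity vector
  set n : ZMod 3 → ℕ := fun a => (H.filter fun h => r h = a).card with hn
  have step : ∀ y : Fin Z → Bool, AffBells33.onesCard y % 2 = 0 → y t₀ = false →
      n (tsum P y h₁) % 2 = n (tsum P y h₁ + P h₁ t₀) % 2 := by
    intro y hy hy0
    have hy' : AffBells33.onesCard (wflip t₀ t₁ y) % 2 = 0 := by rw [onesCard_wflip h01 y hy0]; exact hy
    have hw := windowFlip_count P r τ h01 hfree y hy0 (by rw [hperf y hy, hperf _ hy'])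
    have hsum : ∀ b ∈ H, tsum P y b = tsum P y h₁ := by
      intro b hb; unfold tsum; exact sum_congr rfl fun t _ => by rw [htwin b hb]
    -- rewrite both filters through the crowd
    have hL : (univ.filter fun b => P b t₀ ≠ 0 ∧ tsum P y b = r b) =
        H.filter fun b => r b = tsum P y h₁ := by
      ext b
      simp only [mem_filter, mem_univ, true_and]
      constructor
      · rintro ⟨hb, h⟩
        have hbH := (hH b).1 hb
        exact ⟨hbH, by rw [← h, hsum b hbH]⟩
      · rintro ⟨hbH, h⟩
        exact ⟨(hH b).2 hbH, by rw [hsum b hbH, h]⟩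
    have hR : (univ.filter fun b => P b t₀ ≠ 0 ∧ tsum P y b + P b t₀ = r b) =
        H.filter fun b => r b = tsum P y h₁ + P h₁ t₀ := by
      ext b
      simp only [mem_filter, mem_univ, true_and]
      constructor
      · rintro ⟨hb, h⟩
        have hbH := (hH b).1 hb
        exact ⟨hbH, by rw [← h, hsum b hbH, htwin b hbH]⟩
      · rintro ⟨hbH, h⟩
        exact ⟨(hH b).2 hbH, by rw [hsum b hbH, htwin b hbH, h]⟩
    rw [hL, hR] at hw
    exact hw
  have e0 := step (fun _ => false) onesCard_zeroY rfl
  have e2 := step (pairY t₂ t₁) (onesCard_pairY h12.symm) (pairY_apply_of_ne h02 h01)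
  have e3 := step (pairY t₃ t₁) (onesCard_pairY h13.symm) (pairY_apply_of_ne h03 h01)
  have e23 := step (pairY t₂ t₃) (onesCard_pairY h23) (pairY_apply_of_ne h02 h03)
  rw [tsum_zeroY] at e0
  rw [tsum_pairY P h12.symm, hfree h₁] at e2
  rw [tsum_pairY P h13.symm, hfree h₁] at e3
  rw [tsum_pairY P h23] at e23
  -- pass to `Fin 2`-valued parities and finish by `decide`
  let q : ZMod 3 → Fin 2 := fun a => ⟨n a % 2, Nat.mod_lt _ two_pos⟩
  have hq : ∀ a b : ZMod 3, n a % 2 = n b % 2 → q a = q b := fun a b h => Fin.ext h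
  have hfin := twinCrowd_endgame (P h₁ t₀) (P h₁ t₂) (P h₁ t₃) hδ ha hb q
    (hq _ _ e0) (hq _ _ e2) (hq _ _ e3) (hq _ _ e23)
  exact ⟨congrArg Fin.val hfin.1, congrArg Fin.val hfin.2⟩

end TwinCrowd


section HPrivatePair

open AffBells33 AffBells28 AffBells28lit

variable {Z K : ℕ}

/-- splitting one element off a filtered count. -/
theorem card_filter_split_one (Q : Fin K → Prop) [DecidablePred Q] (h : Fin K) :
    (univ.filter Q).card = (univ.filter fun b => b ≠ h ∧ Q b).card + (if Q h then 1 else 0) := by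
  rw [← card_filter_add_card_filter_not (s := univ.filter Q) (p := fun b => b ≠ h),
    filter_filter, filter_filter]
  congr 1
  · congr 1; ext b; simp [and_comm]
  · have hs : (univ.filter fun b => Q b ∧ ¬ b ≠ h) = if Q h then ({h} : Finset (Fin K)) else ∅ := by
      ext b
      simp only [mem_filter, mem_univ, true_and, not_not]
      by_cases hq : Q h
      · simp only [hq, ↓reduceIte, mem_singleton]
        constructor
        · rintro ⟨-, rfl⟩; rfl
        · rintro rfl; exact ⟨hq, rfl⟩
      · simp only [hq, ↓reduceIte]
        constructor
        · rintro ⟨hb, rfl⟩; exact absurd hb hq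
        · intro hb; simp at hb
    rw [hs]
    split_ifs <;> simp

/-- endgame of L3: the parity pattern of `[s = r] , [s + δ = r]` cannot be balanced against constants at all of `0, a, b, a+b`. -/
theorem hPrivatePair_endgame : ∀ δ a b r : ZMod 3, δ ≠ 0 → a ≠ 0 → b ≠ 0 → ∀ α β : Fin 2,
    (α.val + (if (0 : ZMod 3) = r then 1 else 0)) % 2 = (β.val + (if (0 : ZMod 3) + δ = r then 1 else 0)) % 2 →
    (α.val + (if a + 0 = r then 1 else 0)) % 2 = (β.val + (if a + 0 + δ = r then 1 else 0)) % 2 →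
    (α.val + (if b + 0 = r then 1 else 0)) % 2 = (β.val + (if b + 0 + δ = r then 1 else 0)) % 2 →
    (α.val + (if a + b = r then 1 else 0)) % 2 = (β.val + (if a + b + δ = r then 1 else 0)) % 2 → False := by
  decide

/-- **L3 — the H-PRIVATE PAIR LEMMA (ROUND-34 §12.12(v)(10), test coordinates).**  On a perfect fibre with a free coin `t₁`, no active
reader `h` of a coin `t₀` has TWO coins `t₂, t₃` that no other active reader of `t₀` reads (outside readers allowed).
`privateCoinLemma` is the case where `h` is the only reader of `t₀`. -/
theorem hPrivatePair (P : Fin K → Fin Z → ZMod 3) (r : Fin K → ZMod 3) (τ : ℕ) {t₀ t₁ t₂ t₃ : Fin Z}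
    (h01 : t₀ ≠ t₁) (h02 : t₀ ≠ t₂) (h03 : t₀ ≠ t₃) (h12 : t₁ ≠ t₂) (h13 : t₁ ≠ t₃) (h23 : t₂ ≠ t₃)
    (hfree : ∀ b, P b t₁ = 0) {h : Fin K} (hδ : P h t₀ ≠ 0) (ha : P h t₂ ≠ 0) (hb : P h t₃ ≠ 0)
    (hpriv : ∀ b, b ≠ h → P b t₀ ≠ 0 → P b t₂ = 0 ∧ P b t₃ = 0)
    (hperf : ∀ y : Fin Z → Bool, AffBells33.onesCard y % 2 = 0 → testCount P r τ y % 2 = 0) : False := by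
  -- the y-independent parts of the two counts
  set A := (univ.filter fun b => b ≠ h ∧ (P b t₀ ≠ 0 ∧ (0 : ZMod 3) = r b)).card with hA
  set B := (univ.filter fun b => b ≠ h ∧ (P b t₀ ≠ 0 ∧ (0 : ZMod 3) + P b t₀ = r b)).card with hB
  have step : ∀ y : Fin Z → Bool, AffBells33.onesCard y % 2 = 0 → y t₀ = false →
      (∀ b, b ≠ h → P b t₀ ≠ 0 → tsum P y b = 0) →
      (A + (if tsum P y h = r h then 1 else 0)) % 2 = (B + (if tsum P y h + P h t₀ = r h then 1 else 0)) % 2 := by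
    intro y hy hy0 hyH
    have hy' : AffBells33.onesCard (wflip t₀ t₁ y) % 2 = 0 := by rw [onesCard_wflip h01 y hy0]; exact hy
    have hw := windowFlip_count P r τ h01 hfree y hy0 (by rw [hperf y hy, hperf _ hy'])
    rw [card_filter_split_one (fun b => P b t₀ ≠ 0 ∧ tsum P y b = r b) h,
      card_filter_split_one (fun b => P b t₀ ≠ 0 ∧ tsum P y b + P b t₀ = r b) h] at hw
    have hL : (univ.filter fun b => b ≠ h ∧ (P b t₀ ≠ 0 ∧ tsum P y b = r b)) =
        univ.filter fun b => b ≠ h ∧ (P b t₀ ≠ 0 ∧ (0 : ZMod 3) = r b) := by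
      ext b
      simp only [mem_filter, mem_univ, true_and]
      constructor
      · rintro ⟨hb, h0, h1⟩; exact ⟨hb, h0, by rw [← h1, hyH b hb h0]⟩
      · rintro ⟨hb, h0, h1⟩; exact ⟨hb, h0, by rw [hyH b hb h0, h1]⟩
    have hR : (univ.filter fun b => b ≠ h ∧ (P b t₀ ≠ 0 ∧ tsum P y b + P b t₀ = r b)) =
        univ.filter fun b => b ≠ h ∧ (P b t₀ ≠ 0 ∧ (0 : ZMod 3) + P b t₀ = r b) := by
      ext b
      simp only [mem_filter, mem_univ, true_and]
      constructor
      · rintro ⟨hb, h0, h1⟩; exact ⟨hb, h0, by rw [← h1, hyH b hb h0]⟩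
      · rintro ⟨hb, h0, h1⟩; exact ⟨hb, h0, by rw [hyH b hb h0, h1]⟩
    rw [hL, hR] at hw
    have h1 : (if (P h t₀ ≠ 0 ∧ tsum P y h = r h) then 1 else 0) = (if tsum P y h = r h then 1 else 0) := by
      simp [hδ]
    have h2 : (if (P h t₀ ≠ 0 ∧ tsum P y h + P h t₀ = r h) then 1 else 0) =
        (if tsum P y h + P h t₀ = r h then 1 else 0) := by
      simp [hδ]
    rw [h1, h2] at hw
    exact hw
  -- the four base points
  have oth0 : ∀ b, b ≠ h → P b t₀ ≠ 0 → tsum P (fun _ => false) b = 0 := fun b _ _ => tsum_zeroY P b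
  have oth2 : ∀ b, b ≠ h → P b t₀ ≠ 0 → tsum P (pairY t₂ t₁) b = 0 := by
    intro b hb h0; rw [tsum_pairY P h12.symm, (hpriv b hb h0).1, hfree b, add_zero]
  have oth3 : ∀ b, b ≠ h → P b t₀ ≠ 0 → tsum P (pairY t₃ t₁) b = 0 := by
    intro b hb h0; rw [tsum_pairY P h13.symm, (hpriv b hb h0).2, hfree b, add_zero]
  have oth23 : ∀ b, b ≠ h → P b t₀ ≠ 0 → tsum P (pairY t₂ t₃) b = 0 := by
    intro b hb h0; rw [tsum_pairY P h23, (hpriv b hb h0).1, (hpriv b hb h0).2, add_zero]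
  have e0 := step (fun _ => false) onesCard_zeroY rfl oth0
  have e2 := step (pairY t₂ t₁) (onesCard_pairY h12.symm) (pairY_apply_of_ne h02 h01) oth2
  have e3 := step (pairY t₃ t₁) (onesCard_pairY h13.symm) (pairY_apply_of_ne h03 h01) oth3
  have e23 := step (pairY t₂ t₃) (onesCard_pairY h23) (pairY_apply_of_ne h02 h03) oth23
  rw [tsum_zeroY] at e0
  rw [tsum_pairY P h12.symm, hfree h] at e2
  rw [tsum_pairY P h13.symm, hfree h] at e3
  rw [tsum_pairY P h23] at e23
  -- reduce the constants mod 2 and finish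
  have hα : A % 2 < 2 := Nat.mod_lt _ two_pos
  have hβ : B % 2 < 2 := Nat.mod_lt _ two_pos
  refine hPrivatePair_endgame (P h t₀) (P h t₂) (P h t₃) (r h) hδ ha hb ⟨A % 2, hα⟩ ⟨B % 2, hβ⟩ ?_ ?_ ?_ ?_
  · simp only []; omega
  · simp only []; omega
  · simp only []; omega
  · simp only []; omega

end HPrivatePair

end Summit.QuantumAdvantage.AdviceFreeQNC0.AffBells35
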